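import Literature.NumberTheory.Sieve.CFSemigroupLipOperator
import Literature.NumberTheory.Sieve.CFSemigroupSpectralGap
import HarnessLib

/-!
# The Ruelle–Perron–Frobenius data at `s = δ_A` on the Lipschitz space

Support file (all results proved) for the named fact
`Literature.NumberTheory.Sieve.MageeOhWinter2019_uniformCounting` (`CFSemigroupCounting.lean`).
At the critical exponent `s = δ = δ_A` the pressure vanishes (Bowen's formula,
`cfPressure_cfDimension`), so the transfer operator `L_δ` has leading eigenvalue `1`; the
Ruelle–Perron–Frobenius theorem ([MageeOhWinter2019, Thm. 10], `cfTransfer_spectralGap`) provides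
the positive eigenfunction `h` and the eigen-probability-measure `ν` with `∫ h dν = 1` and the
exponential convergence `L_δⁿ f → (∫ f dν) h`. This file packages these data on the Banach space
`CfLip` (`CFSemigroupLipSpace.lean`) where the operator-theoretic renewal analysis of
[MageeOhWinter2019, §3] takes place:

* `cfHδ`, `cfNuδ`: a fixed choice of `h`, `ν` at `s = δ_A` with their properties
  (`cfHδ_eigen`, `cfNuδ_eigen`, `cfInt_cfHδ`, `cfHδ_decay`, bounds `e^{-2δ} ≤ h ≤ e^{2δ}`);
* `cfHL : CfLip` (the complexified eigenfunction) and `cfNuL : CfLip →L[ℂ] ℂ` (integration against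
  `ν`), with `L_δ h = h` (`cfLOp_cfHL`), `ν ∘ L_δ = ν` (`cfNuL_cfLOp`), `ν(h) = 1` (`cfNuL_cfHL`);
* the rank-one spectral projection `cfPi = h ⊗ ν` with `Π² = Π`, `L_δ Π = Π L_δ = Π`
  ([MageeOhWinter2019, Thm. 10 (3)]: `L_δ = Π + Q` with `Π Q = Q Π = 0`);
* `norm_cfLOp_pow_apply_sub_le`: the sup-norm convergence
  `‖(L_δⁿ F)(x) - ν(F) h(x)‖ ≤ 4 C(δ) θ(δ)ⁿ ‖F‖` for complex Lipschitz `F`.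

## References

* M. Magee, H. Oh, D. Winter, J. reine angew. Math. 753 (2019) 89–135, Thm. 10, §3.3.
  [MageeOhWinter2019]
-/

noncomputable section

open Set Filter MeasureTheory
open scoped Topology

namespace Literature.NumberTheory.Sieve

variable {A : Finset ℕ}

/-! ### The leading eigenvalue at `δ_A` is `1` -/

/-- **Bowen's formula in eigenvalue form:** `e^{P_A(δ_A)} = 1`. [cite: MageeOhWinter2019, §2.2] -/
theorem cfEig_cfDimension (hA : ∀ a ∈ A, 1 ≤ a) (h2 : 2 ≤ A.card) : cfEig A (cfDimension A) = 1 := by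
  rw [cfEig, cfPressure_cfDimension hA h2, Real.exp_zero]

/-! ### Real and imaginary parts -/

/-- Real and imaginary parts of the extension of `F ∈ CfLip`: continuous, bounded by `‖F‖`,
`‖F‖`-Lipschitz on `[0,1]`. [folklore] -/
theorem cfLip_re_im (F : CfLip) :
    (Continuous fun y => (F.extend y).re) ∧ (Continuous fun y => (F.extend y).im) ∧
      (∀ y ∈ Icc (0 : ℝ) 1, |(F.extend y).re| ≤ ‖F‖) ∧ (∀ y ∈ Icc (0 : ℝ) 1, |(F.extend y).im| ≤ ‖F‖) ∧
      (∀ x ∈ Icc (0 : ℝ) 1, ∀ y ∈ Icc (0 : ℝ) 1, |(F.extend x).re - (F.extend y).re| ≤ ‖F‖ * |x - y|) ∧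
      (∀ x ∈ Icc (0 : ℝ) 1, ∀ y ∈ Icc (0 : ℝ) 1, |(F.extend x).im - (F.extend y).im| ≤ ‖F‖ * |x - y|) := by
  have hext : Continuous F.extend := F.continuous.comp continuous_projIcc
  refine ⟨Complex.continuous_re.comp hext, Complex.continuous_im.comp hext,
    fun y _ => (Complex.abs_re_le_norm _).trans (F.norm_extend_le y),
    fun y _ => (Complex.abs_im_le_norm _).trans (F.norm_extend_le y),
    fun x hx y hy => ?_, fun x hx y hy => ?_⟩
  · rw [← Complex.sub_re]
    exact (Complex.abs_re_le_norm _).trans (F.norm_extend_sub_le hx hy)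
  · rw [← Complex.sub_im]
    exact (Complex.abs_im_le_norm _).trans (F.norm_extend_sub_le hx hy)

/-- Decomposition of the complex iterates into real ones:
`(L_δⁿ F)(x) = (L_δⁿ Re F)(x) + i (L_δⁿ Im F)(x)` on `[0,1]`. [folklore] -/
theorem cfLC_iterate_re_im (hA : ∀ a ∈ A, 1 ≤ a) (F : CfLip) (n : ℕ) {x : ℝ} (hx : x ∈ Icc (0 : ℝ) 1) :
    (cfLC A (cfDimension A : ℂ))^[n] F.extend x =
      (((cfTransfer A (cfDimension A))^[n] (fun y => (F.extend y).re) x : ℝ) : ℂ) +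
        (((cfTransfer A (cfDimension A))^[n] (fun y => (F.extend y).im) x : ℝ) : ℂ) * Complex.I := by
  have hsplit : ∀ y ∈ Icc (0 : ℝ) 1, F.extend y =
      (fun y => ((F.extend y).re : ℂ) + Complex.I * ((F.extend y).im : ℂ)) y := fun y _ => by
    simp only [mul_comm Complex.I]
    exact (Complex.re_add_im _).symm
  rw [cfLC_iterate_congr hA _ n hsplit hx, cfLC_iterate_add hA _ n _ _ hx,
    cfLC_iterate_const_mul hA _ n Complex.I _ hx, cfLC_iterate_ofReal hA _ n _ hx,
    cfLC_iterate_ofReal hA _ n _ hx]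
  ring

/-! ### A fixed choice of the RPF data at `s = δ_A` -/

section RPF

variable (A) (hA : ∀ a ∈ A, 1 ≤ a) (h2 : 2 ≤ A.card)
include hA h2

/-- The RPF package at `s = δ_A` (from `cfTransfer_spectralGap`). [cite: MageeOhWinter2019, Thm. 10] -/
theorem cfRPF_exists :
    ∃ (h : ℝ → ℝ) (ν : Measure (Icc (0 : ℝ) 1)), IsProbabilityMeasure ν ∧
      (∀ f : C(Icc (0 : ℝ) 1, ℝ),
        ∫ x, cfTransferC A hA (cfDimension A) f x ∂ν = cfEig A (cfDimension A) * ∫ x, f x ∂ν) ∧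
      CfCone (2 * cfDimension A) h ∧
      (∀ x ∈ Icc (0 : ℝ) 1, cfTransfer A (cfDimension A) h x = cfEig A (cfDimension A) * h x) ∧
      cfInt ν h = 1 ∧
      ∀ (f : ℝ → ℝ) (M L : ℝ), 0 ≤ M → 0 ≤ L → (∀ y ∈ Icc (0 : ℝ) 1, |f y| ≤ M) →
        (∀ x ∈ Icc (0 : ℝ) 1, ∀ y ∈ Icc (0 : ℝ) 1, |f x - f y| ≤ L * |x - y|) →
        ∀ n : ℕ, ∀ x ∈ Icc (0 : ℝ) 1,
          |(cfEig A (cfDimension A) ^ n)⁻¹ * (cfTransfer A (cfDimension A))^[n] f x - cfInt ν f * h x| ≤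
            cfGapConst (cfDimension A) * cfTheta (cfDimension A) ^ n * (M + L) :=
  cfTransfer_spectralGap hA (nonempty_of_two_le_card h2) (cfDimension_pos hA h2).le

/-- **The RPF eigenfunction `h` at `s = δ_A`** (a fixed choice). [cite: MageeOhWinter2019, Thm. 10] -/
def cfHδ : ℝ → ℝ := Classical.choose (cfRPF_exists A hA h2)

/-- **The RPF eigenmeasure `ν` at `s = δ_A`** (a fixed choice, a probability measure on `[0,1]`).
[cite: MageeOhWinter2019, Thm. 10] -/
def cfNuδ : Measure (Icc (0 : ℝ) 1) := Classical.choose (Classical.choose_spec (cfRPF_exists A hA h2))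

/-- The defining properties of the chosen RPF data. [cite: MageeOhWinter2019, Thm. 10] -/
theorem cfRPF_spec :
    IsProbabilityMeasure (cfNuδ A hA h2) ∧
      (∀ f : C(Icc (0 : ℝ) 1, ℝ),
        ∫ x, cfTransferC A hA (cfDimension A) f x ∂(cfNuδ A hA h2) =
          cfEig A (cfDimension A) * ∫ x, f x ∂(cfNuδ A hA h2)) ∧
      CfCone (2 * cfDimension A) (cfHδ A hA h2) ∧
      (∀ x ∈ Icc (0 : ℝ) 1,
        cfTransfer A (cfDimension A) (cfHδ A hA h2) x = cfEig A (cfDimension A) * cfHδ A hA h2 x) ∧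
      cfInt (cfNuδ A hA h2) (cfHδ A hA h2) = 1 ∧
      ∀ (f : ℝ → ℝ) (M L : ℝ), 0 ≤ M → 0 ≤ L → (∀ y ∈ Icc (0 : ℝ) 1, |f y| ≤ M) →
        (∀ x ∈ Icc (0 : ℝ) 1, ∀ y ∈ Icc (0 : ℝ) 1, |f x - f y| ≤ L * |x - y|) →
        ∀ n : ℕ, ∀ x ∈ Icc (0 : ℝ) 1,
          |(cfEig A (cfDimension A) ^ n)⁻¹ * (cfTransfer A (cfDimension A))^[n] f x -
              cfInt (cfNuδ A hA h2) f * cfHδ A hA h2 x| ≤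
            cfGapConst (cfDimension A) * cfTheta (cfDimension A) ^ n * (M + L) :=
  Classical.choose_spec (Classical.choose_spec (cfRPF_exists A hA h2))

/-- `ν` is a probability measure. [cite: MageeOhWinter2019, Thm. 10] -/
instance isProbabilityMeasure_cfNuδ : IsProbabilityMeasure (cfNuδ A hA h2) := (cfRPF_spec A hA h2).1

/-- **Eigenmeasure relation** `∫ L_δ f dν = ∫ f dν` for `f ∈ C([0,1])`. [cite: MageeOhWinter2019, Thm. 10] -/
theorem cfNuδ_eigen (f : C(Icc (0 : ℝ) 1, ℝ)) :
    ∫ x, cfTransferC A hA (cfDimension A) f x ∂(cfNuδ A hA h2) =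
      cfEig A (cfDimension A) * ∫ x, f x ∂(cfNuδ A hA h2) :=
  (cfRPF_spec A hA h2).2.1 f

/-- `h ∈ C_{2δ}` (positive, log-Lipschitz). [cite: MageeOhWinter2019, Thm. 10] -/
theorem cfHδ_cone : CfCone (2 * cfDimension A) (cfHδ A hA h2) := (cfRPF_spec A hA h2).2.2.1

/-- **Eigenfunction relation** `L_δ h = h` on `[0,1]`. [cite: MageeOhWinter2019, Thm. 10] -/
theorem cfHδ_eigen {x : ℝ} (hx : x ∈ Icc (0 : ℝ) 1) :
    cfTransfer A (cfDimension A) (cfHδ A hA h2) x = cfHδ A hA h2 x := by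
  rw [(cfRPF_spec A hA h2).2.2.2.1 x hx, cfEig_cfDimension hA h2, one_mul]

/-- **Normalisation** `∫ h dν = 1`. [cite: MageeOhWinter2019, Thm. 10] -/
theorem cfInt_cfHδ : cfInt (cfNuδ A hA h2) (cfHδ A hA h2) = 1 := (cfRPF_spec A hA h2).2.2.2.2.1

/-- **Exponential convergence** `|L_δⁿ f (x) - (∫ f dν) h(x)| ≤ C θⁿ (M + L)` for real Lipschitz `f`.
[cite: MageeOhWinter2019, Thm. 10] -/
theorem cfHδ_decay {f : ℝ → ℝ} {M L : ℝ} (hM0 : 0 ≤ M) (hL0 : 0 ≤ L)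
    (hM : ∀ y ∈ Icc (0 : ℝ) 1, |f y| ≤ M)
    (hL : ∀ x ∈ Icc (0 : ℝ) 1, ∀ y ∈ Icc (0 : ℝ) 1, |f x - f y| ≤ L * |x - y|) (n : ℕ) {x : ℝ}
    (hx : x ∈ Icc (0 : ℝ) 1) :
    |(cfTransfer A (cfDimension A))^[n] f x - cfInt (cfNuδ A hA h2) f * cfHδ A hA h2 x| ≤
      cfGapConst (cfDimension A) * cfTheta (cfDimension A) ^ n * (M + L) := by
  have h := (cfRPF_spec A hA h2).2.2.2.2.2 f M L hM0 hL0 hM hL n x hx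
  rwa [cfEig_cfDimension hA h2, one_pow, inv_one, one_mul] at h

/-- `δ_A ≥ 0`. [folklore] -/
theorem cfDimension_nonneg : 0 ≤ cfDimension A := (cfDimension_pos hA h2).le

/-- Upper bound `h ≤ e^{2δ}` on `[0,1]`. [cite: MageeOhWinter2019, Thm. 10] -/
theorem cfHδ_le {y : ℝ} (hy : y ∈ Icc (0 : ℝ) 1) : cfHδ A hA h2 y ≤ Real.exp (2 * cfDimension A) := by
  have h := (cfHδ_cone A hA h2).le_exp_mul_cfInt (cfNuδ A hA h2)
    (by linarith [cfDimension_nonneg A hA h2]) hy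
  rwa [cfInt_cfHδ, mul_one] at h

/-- Lower bound `e^{-2δ} ≤ h` on `[0,1]`. [cite: MageeOhWinter2019, Thm. 10] -/
theorem le_cfHδ {y : ℝ} (hy : y ∈ Icc (0 : ℝ) 1) : Real.exp (-(2 * cfDimension A)) ≤ cfHδ A hA h2 y := by
  have h := (cfHδ_cone A hA h2).exp_neg_mul_cfInt_le (cfNuδ A hA h2)
    (by linarith [cfDimension_nonneg A hA h2]) hy
  rwa [cfInt_cfHδ, mul_one] at h

/-- `h > 0` on `[0,1]`. [cite: MageeOhWinter2019, Thm. 10] -/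
theorem cfHδ_pos {y : ℝ} (hy : y ∈ Icc (0 : ℝ) 1) : 0 < cfHδ A hA h2 y := (cfHδ_cone A hA h2).pos y hy

/-- Lipschitz bound for `h`: `|h x - h y| ≤ 2δ e^{2δ} e^{2δ} |x - y|`. [cite: MageeOhWinter2019, Thm. 10] -/
theorem abs_cfHδ_sub_le {x y : ℝ} (hx : x ∈ Icc (0 : ℝ) 1) (hy : y ∈ Icc (0 : ℝ) 1) :
    |cfHδ A hA h2 x - cfHδ A hA h2 y| ≤
      2 * cfDimension A * Real.exp (2 * cfDimension A) * Real.exp (2 * cfDimension A) * |x - y| :=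
  (cfHδ_cone A hA h2).abs_sub_le (by linarith [cfDimension_nonneg A hA h2])
    (fun y hy => cfHδ_le A hA h2 hy) hx hy

/-- `h` is continuous on `[0,1]`. [folklore] -/
theorem continuousOn_cfHδ : ContinuousOn (cfHδ A hA h2) (Icc 0 1) :=
  (cfHδ_cone A hA h2).continuousOn (by linarith [cfDimension_nonneg A hA h2])

/-! ### The eigenfunction and the eigenmeasure on `CfLip` -/

/-- **The complexified RPF eigenfunction as an element of `CfLip`.** [cite: MageeOhWinter2019, Thm. 10] -/
def cfHL : CfLip :=
  CfLip.mk' (fun x => (cfHδ A hA h2 x : ℂ))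
    (2 * cfDimension A * Real.exp (2 * cfDimension A) * Real.exp (2 * cfDimension A)) fun x y => by
    rw [← Complex.ofReal_sub, Complex.norm_real, Real.norm_eq_abs]
    exact abs_cfHδ_sub_le A hA h2 x.2 y.2

/-- Pointwise formula. [folklore] -/
@[simp] theorem cfHL_apply (x : Icc (0 : ℝ) 1) : cfHL A hA h2 x = (cfHδ A hA h2 x : ℂ) := rfl

/-- The extension of `cfHL` agrees with `h` on `[0,1]`. [folklore] -/
theorem cfHL_extend {y : ℝ} (hy : y ∈ Icc (0 : ℝ) 1) : (cfHL A hA h2).extend y = (cfHδ A hA h2 y : ℂ) := by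
  rw [CfLip.extend_of_mem _ hy]; rfl

/-- Elements of `CfLip` are integrable against `ν`. [folklore] -/
theorem integrable_cfLip (F : CfLip) : Integrable (fun x : Icc (0 : ℝ) 1 => F x) (cfNuδ A hA h2) :=
  F.continuous.integrable_of_hasCompactSupport (HasCompactSupport.of_compactSpace _)

/-- **Integration against `ν` as a bounded functional on `CfLip`.** [cite: MageeOhWinter2019, Thm. 10] -/
def cfNuL : CfLip →L[ℂ] ℂ :=
  LinearMap.mkContinuous
    { toFun := fun F => ∫ x, F x ∂(cfNuδ A hA h2)
      map_add' := fun F G => by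
        simp only [CfLip.add_apply]
        exact integral_add (integrable_cfLip A hA h2 F) (integrable_cfLip A hA h2 G)
      map_smul' := fun c F => by
        simp only [CfLip.smul_apply, RingHom.id_apply, smul_eq_mul]
        exact integral_const_mul c _ }
    1 fun F => by
      rw [one_mul]
      have h := norm_integral_le_of_norm_le_const (μ := cfNuδ A hA h2) (f := fun x : Icc (0 : ℝ) 1 => F x)
        (C := ‖F‖) (Eventually.of_forall fun x => F.norm_apply_le x)
      simpa using h

/-- Pointwise formula. [folklore] -/
@[simp] theorem cfNuL_apply (F : CfLip) : cfNuL A hA h2 F = ∫ x, F x ∂(cfNuδ A hA h2) := rfl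

/-- `‖ν‖ ≤ 1`. [folklore] -/
theorem norm_cfNuL_le : ‖cfNuL A hA h2‖ ≤ 1 :=
  LinearMap.mkContinuous_norm_le _ zero_le_one _

/-- `ν` on real-valued elements is the real integral. [folklore] -/
theorem cfNuL_of_real {F : CfLip} {g : ℝ → ℝ} (hF : ∀ x : Icc (0 : ℝ) 1, F x = (g x : ℂ)) :
    cfNuL A hA h2 F = ((cfInt (cfNuδ A hA h2) g : ℝ) : ℂ) := by
  rw [cfNuL_apply, cfInt, ← integral_complex_ofReal]
  exact integral_congr_ae (Eventually.of_forall fun x => hF x)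

/-- **Normalisation on `CfLip`:** `ν(h) = 1`. [cite: MageeOhWinter2019, Thm. 10] -/
theorem cfNuL_cfHL : cfNuL A hA h2 (cfHL A hA h2) = 1 := by
  rw [cfNuL_of_real A hA h2 (g := cfHδ A hA h2) (fun x => rfl), cfInt_cfHδ]
  simp

/-- **The eigenfunction equation on `CfLip`:** `L_δ h = h`. [cite: MageeOhWinter2019, Thm. 10] -/
theorem cfLOp_cfHL : cfLOp A hA (cfDimension A : ℂ) (cfHL A hA h2) = cfHL A hA h2 := by
  ext x
  rw [cfLOp_apply, cfHL_apply,
    cfLC_congr hA _ (g' := fun y => (cfHδ A hA h2 y : ℂ)) (fun y hy => cfHL_extend A hA h2 hy) x.2,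
    cfLC_ofReal hA _ _ x.2, cfHδ_eigen A hA h2 x.2]

/-- **Eigenmeasure relation on `CfLip`:** `ν(L_δ F) = ν(F)`. [cite: MageeOhWinter2019, Thm. 10] -/
theorem cfNuL_cfLOp (F : CfLip) : cfNuL A hA h2 (cfLOp A hA (cfDimension A : ℂ) F) = cfNuL A hA h2 F := by
  obtain ⟨hcu, hcv, -, -, -, -⟩ := cfLip_re_im F
  set u : ℝ → ℝ := fun y => (F.extend y).re with hu
  set v : ℝ → ℝ := fun y => (F.extend y).im with hv
  have hTu := cfInt_cfTransfer hA (cfNuδ A hA h2) (cfNuδ_eigen A hA h2) hcu.continuousOn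
  have hTv := cfInt_cfTransfer hA (cfNuδ A hA h2) (cfNuδ_eigen A hA h2) hcv.continuousOn
  rw [cfEig_cfDimension hA h2, one_mul] at hTu hTv
  -- both sides as real integrals
  have hL : cfNuL A hA h2 (cfLOp A hA (cfDimension A : ℂ) F) =
      ((cfInt (cfNuδ A hA h2) (cfTransfer A (cfDimension A) u) : ℝ) : ℂ) +
        ((cfInt (cfNuδ A hA h2) (cfTransfer A (cfDimension A) v) : ℝ) : ℂ) * Complex.I := by
    rw [cfNuL_apply]
    have hpt : ∀ x : Icc (0 : ℝ) 1, cfLOp A hA (cfDimension A : ℂ) F x =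
        ((cfTransfer A (cfDimension A) u x : ℝ) : ℂ) + ((cfTransfer A (cfDimension A) v x : ℝ) : ℂ) * Complex.I := by
      intro x
      rw [cfLOp_apply]
      have h := cfLC_iterate_re_im hA F 1 x.2
      simpa using h
    simp_rw [hpt]
    have hiu : Integrable (fun x : Icc (0 : ℝ) 1 => ((cfTransfer A (cfDimension A) u x : ℝ) : ℂ)) (cfNuδ A hA h2) :=
      (cfIntegrable _ (continuousOn_cfTransfer hA _ hcu.continuousOn)).ofReal
    have hiv : Integrable (fun x : Icc (0 : ℝ) 1 => ((cfTransfer A (cfDimension A) v x : ℝ) : ℂ) * Complex.I)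
        (cfNuδ A hA h2) :=
      (cfIntegrable _ (continuousOn_cfTransfer hA _ hcv.continuousOn)).ofReal.mul_const _
    rw [integral_add hiu hiv, integral_mul_const, integral_complex_ofReal, integral_complex_ofReal]
    rfl
  have hR : cfNuL A hA h2 F =
      ((cfInt (cfNuδ A hA h2) u : ℝ) : ℂ) + ((cfInt (cfNuδ A hA h2) v : ℝ) : ℂ) * Complex.I := by
    rw [cfNuL_apply]
    have hpt : ∀ x : Icc (0 : ℝ) 1, F x = ((u x : ℝ) : ℂ) + ((v x : ℝ) : ℂ) * Complex.I := by
      intro x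
      rw [← CfLip.extend_coe]
      exact (Complex.re_add_im _).symm
    simp_rw [hpt]
    have hiu : Integrable (fun x : Icc (0 : ℝ) 1 => ((u x : ℝ) : ℂ)) (cfNuδ A hA h2) :=
      (cfIntegrable _ hcu.continuousOn).ofReal
    have hiv : Integrable (fun x : Icc (0 : ℝ) 1 => ((v x : ℝ) : ℂ) * Complex.I) (cfNuδ A hA h2) :=
      (cfIntegrable _ hcv.continuousOn).ofReal.mul_const _
    rw [integral_add hiu hiv, integral_mul_const, integral_complex_ofReal, integral_complex_ofReal]
    rfl
  rw [hL, hR, hTu, hTv]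

/-! ### The spectral projection `Π = h ⊗ ν` -/

/-- **The rank-one spectral projection `Π F = ν(F) h`.** [cite: MageeOhWinter2019, Thm. 10] -/
def cfPi : CfLip →L[ℂ] CfLip := (cfNuL A hA h2).smulRight (cfHL A hA h2)

/-- Pointwise formula. [folklore] -/
@[simp] theorem cfPi_apply (F : CfLip) : cfPi A hA h2 F = (cfNuL A hA h2 F) • cfHL A hA h2 := rfl

/-- `Π² = Π` (`ν(h) = 1`). [cite: MageeOhWinter2019, Thm. 10] -/
theorem cfPi_mul_cfPi : cfPi A hA h2 * cfPi A hA h2 = cfPi A hA h2 := by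
  refine ContinuousLinearMap.ext fun F => ?_
  show cfPi A hA h2 (cfPi A hA h2 F) = cfPi A hA h2 F
  rw [cfPi_apply, cfPi_apply, map_smul, cfNuL_cfHL, smul_eq_mul, mul_one]

/-- `L_δ Π = Π` (`L_δ h = h`). [cite: MageeOhWinter2019, Thm. 10] -/
theorem cfLOp_mul_cfPi : cfLOp A hA (cfDimension A : ℂ) * cfPi A hA h2 = cfPi A hA h2 := by
  refine ContinuousLinearMap.ext fun F => ?_
  show cfLOp A hA (cfDimension A : ℂ) (cfPi A hA h2 F) = cfPi A hA h2 F
  rw [cfPi_apply, map_smul, cfLOp_cfHL]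

/-- `Π L_δ = Π` (`ν ∘ L_δ = ν`). [cite: MageeOhWinter2019, Thm. 10] -/
theorem cfPi_mul_cfLOp : cfPi A hA h2 * cfLOp A hA (cfDimension A : ℂ) = cfPi A hA h2 := by
  refine ContinuousLinearMap.ext fun F => ?_
  show cfPi A hA h2 (cfLOp A hA (cfDimension A : ℂ) F) = cfPi A hA h2 F
  rw [cfPi_apply, cfPi_apply, cfNuL_cfLOp]

/-- `L_δⁿ Π = Π`. [folklore] -/
theorem cfLOp_pow_mul_cfPi (n : ℕ) : cfLOp A hA (cfDimension A : ℂ) ^ n * cfPi A hA h2 = cfPi A hA h2 := by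
  induction n with
  | zero => rw [pow_zero, one_mul]
  | succ n ih => rw [pow_succ, mul_assoc, cfLOp_mul_cfPi, ih]

/-- `Π L_δⁿ = Π`. [folklore] -/
theorem cfPi_mul_cfLOp_pow (n : ℕ) : cfPi A hA h2 * cfLOp A hA (cfDimension A : ℂ) ^ n = cfPi A hA h2 := by
  induction n with
  | zero => rw [pow_zero, mul_one]
  | succ n ih => rw [pow_succ', ← mul_assoc, cfPi_mul_cfLOp, ih]

/-- `‖Π‖ ≤ ‖h‖`. [folklore] -/
theorem norm_cfPi_le : ‖cfPi A hA h2‖ ≤ ‖cfHL A hA h2‖ := by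
  refine ContinuousLinearMap.opNorm_le_bound _ (norm_nonneg _) fun F => ?_
  rw [cfPi_apply, norm_smul, mul_comm]
  exact mul_le_mul_of_nonneg_left ((ContinuousLinearMap.le_opNorm _ F).trans
    (by have := norm_cfNuL_le A hA h2; nlinarith [norm_nonneg F])) (norm_nonneg _)

/-! ### Sup-norm convergence for complex Lipschitz functions -/

/-- **Sup-norm convergence on `CfLip`:** `‖(L_δⁿ F)(x) - ν(F) h(x)‖ ≤ 4 C(δ) θ(δ)ⁿ ‖F‖`
(real and imaginary parts separately, [MageeOhWinter2019, Thm. 10 (3)]). [cite: MageeOhWinter2019, Thm. 10] -/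
theorem norm_cfLOp_pow_apply_sub_le (F : CfLip) (n : ℕ) (x : Icc (0 : ℝ) 1) :
    ‖(cfLOp A hA (cfDimension A : ℂ) ^ n) F x - (cfPi A hA h2 F) x‖ ≤
      4 * cfGapConst (cfDimension A) * cfTheta (cfDimension A) ^ n * ‖F‖ := by
  obtain ⟨hcu, hcv, hbu, hbv, hlu, hlv⟩ := cfLip_re_im F
  set u : ℝ → ℝ := fun y => (F.extend y).re with hu
  set v : ℝ → ℝ := fun y => (F.extend y).im with hv
  have hF0 := norm_nonneg F
  have hdu := cfHδ_decay A hA h2 hF0 hF0 hbu hlu n x.2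
  have hdv := cfHδ_decay A hA h2 hF0 hF0 hbv hlv n x.2
  -- the complex quantities in terms of real ones
  have hT : (cfLOp A hA (cfDimension A : ℂ) ^ n) F x =
      (((cfTransfer A (cfDimension A))^[n] u x : ℝ) : ℂ) +
        (((cfTransfer A (cfDimension A))^[n] v x : ℝ) : ℂ) * Complex.I := by
    rw [cfLOp_pow_apply]
    exact cfLC_iterate_re_im hA F n x.2
  have hν : cfNuL A hA h2 F =
      ((cfInt (cfNuδ A hA h2) u : ℝ) : ℂ) + ((cfInt (cfNuδ A hA h2) v : ℝ) : ℂ) * Complex.I := by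
    rw [cfNuL_apply]
    have hpt : ∀ x : Icc (0 : ℝ) 1, F x = ((u x : ℝ) : ℂ) + ((v x : ℝ) : ℂ) * Complex.I := by
      intro x
      rw [← CfLip.extend_coe]
      exact (Complex.re_add_im _).symm
    simp_rw [hpt]
    have hiu : Integrable (fun x : Icc (0 : ℝ) 1 => ((u x : ℝ) : ℂ)) (cfNuδ A hA h2) :=
      (cfIntegrable _ hcu.continuousOn).ofReal
    have hiv : Integrable (fun x : Icc (0 : ℝ) 1 => ((v x : ℝ) : ℂ) * Complex.I) (cfNuδ A hA h2) :=
      (cfIntegrable _ hcv.continuousOn).ofReal.mul_const _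
    rw [integral_add hiu hiv, integral_mul_const, integral_complex_ofReal, integral_complex_ofReal]
    rfl
  rw [cfPi_apply, CfLip.smul_apply, cfHL_apply, hT, hν]
  set Tu := (cfTransfer A (cfDimension A))^[n] u x
  set Tv := (cfTransfer A (cfDimension A))^[n] v x
  set Iu := cfInt (cfNuδ A hA h2) u
  set Iv := cfInt (cfNuδ A hA h2) v
  set hx' := cfHδ A hA h2 x
  have e : ((Tu : ℝ) : ℂ) + ((Tv : ℝ) : ℂ) * Complex.I - (((Iu : ℝ) : ℂ) + ((Iv : ℝ) : ℂ) * Complex.I) * ((hx' : ℝ) : ℂ) =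
      (((Tu - Iu * hx' : ℝ)) : ℂ) + (((Tv - Iv * hx' : ℝ)) : ℂ) * Complex.I := by
    push_cast; ring
  rw [e]
  calc ‖(((Tu - Iu * hx' : ℝ)) : ℂ) + (((Tv - Iv * hx' : ℝ)) : ℂ) * Complex.I‖
      ≤ ‖(((Tu - Iu * hx' : ℝ)) : ℂ)‖ + ‖(((Tv - Iv * hx' : ℝ)) : ℂ) * Complex.I‖ := norm_add_le _ _
    _ = |Tu - Iu * hx'| + |Tv - Iv * hx'| := by
        rw [norm_mul, Complex.norm_I, mul_one, Complex.norm_real, Complex.norm_real,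
          Real.norm_eq_abs, Real.norm_eq_abs]
    _ ≤ cfGapConst (cfDimension A) * cfTheta (cfDimension A) ^ n * (‖F‖ + ‖F‖) +
          cfGapConst (cfDimension A) * cfTheta (cfDimension A) ^ n * (‖F‖ + ‖F‖) := add_le_add hdu hdv
    _ = 4 * cfGapConst (cfDimension A) * cfTheta (cfDimension A) ^ n * ‖F‖ := by ring

end RPF

end Literature.NumberTheory.Sieve
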